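import Literature.NumberTheory.Automorphic.LieAlgebraGLDerivation
import Literature.NumberTheory.Automorphic.TorusCharacters
import HarnessLib

/-!
# The Lie algebra of an algebraic subgroup of the diagonal torus (Springer 3.2, 4.4.10 (3))
(trunk T-AUTOMORPHIC, G25 AutomorphicL)

Companion to `LieAlgebraGLDerivation.lean` (the derivations `D_X` of `k[x_{ij}, y]` and the
criterion `X ∈ Lie(G) ↔ D_X 𝓘(G) ⊆ 𝓘(G)`) and `TorusCharacters.lean` (subgroups `T ≤ 𝔻ₙ` of the
diagonal torus: the monomial characters `diagChar hT m : t ↦ ∏ (t i i) ^ m i`, the restriction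
`laurentRestrict : k[x_{ij}, det⁻¹] → k[ℤⁿ]` of polynomials to `𝔻ₙ` and Dedekind's theorem),
namespace `Literature.NumberTheory.Automorphic`. For an *algebraic* subgroup `T ≤ 𝔻ₙ` (e.g. a
torus conjugated into `𝔻ₙ`) this file computes its Lie algebra inside `𝔤𝔩ₙ`:

* `apply_eq_zero_of_mem_lieAlgebraGL` — `Lie(T)` consists of diagonal matrices
  (`exists_eq_diagonal_of_mem_lieAlgebraGL`);
* `laurentDeriv v` — the Euler derivation `t^m ↦ ⟨m, v⟩ t^m` of `k[ℤⁿ]` (`⟨m, v⟩ = zdot m v =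
  ∑ mᵢ vᵢ`), and **`laurentRestrict_rDeriv_diagonal`**: restriction to the diagonal intertwines
  `D_{diag(v)}` with `laurentDeriv v`;
* **`diagonal_mem_lieAlgebraGL_of_forall_diagChar`** — if `⟨m, v⟩ = 0` for every `m ∈ ℤⁿ` whose
  character `t ↦ t^m` is trivial on `T`, then `diag(v) ∈ Lie(T)`. (Springer 3.2.10 (4) describes
  the closed subgroups of `𝔻ₙ` as intersections of kernels of characters; infinitesimally, the Lie
  algebra of `T = ⋂_{m ∈ M} Ker (t ↦ t^m)` is `{diag(v) | ⟨m, v⟩ = 0, m ∈ M}`; this is the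
  inclusion `⊇`, proved through Dedekind's independence of characters exactly as
  `diagonalGL_mem_of_forall_diagChar` of `TorusCharacters.lean`: a polynomial `p` vanishing on
  `T` has, class by class of monomials with the same character on `T`, coefficient sum zero, and
  `D_{diag(v)}` multiplies each class by the constant `⟨m, v⟩`.)

This is the torus half of the "algebraic hull" argument (Chevalley): for a semisimple
`S = diag(s) ∈ Lie(G)` the torus `T_s = ⋂_{⟨m, s⟩ = 0} Ker (t^m)` lies in `G`
(`LieAlgebraGLTorusHull.lean`), and `S ∈ Lie(T)` for every algebraic `T ⊇ T_s` by the present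
file.

## Mathlib

`AddMonoidAlgebra` (`single`, `coeff`, `induction_linear`, `single_mul_single`),
`linearIndependent_monoidHom` (Dedekind, through `sum_filter_eq_zero_of_sum_smul_monoidHom_eq_zero`
of `TorusCharacters.lean`). Nothing here duplicates a Mathlib declaration (Mathlib has no algebraic
tori; searched `laurentDeriv`, `Euler` + `AddMonoidAlgebra`).

## References

* T. A. Springer, *Linear Algebraic Groups*, 2nd ed., Progress in Mathematics 9, Birkhäuser
  (1998), 3.2.1–3.2.2, 3.2.10 (4), 4.4.10 (3) [SpringerLAG1998].
-/

noncomputable section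

open MvPolynomial

namespace Literature.NumberTheory.Automorphic

variable {k : Type*} [Field k] {n : Type*} [Fintype n] [DecidableEq n]

/-! ### `Lie(T)` is diagonal for `T ≤ 𝔻ₙ` -/

section Diagonal

variable {T : Subgroup (GL n k)}

/-- For `T ≤ 𝔻ₙ` the off-diagonal coordinates vanish on `T`, so their differentials kill
`Lie(T)`: every `A ∈ Lie(T)` is diagonal. [cite: SpringerLAG1998, 4.4.10 (3)] -/
theorem apply_eq_zero_of_mem_lieAlgebraGL (hT : T ≤ diagonalSubgroup n k) {A : Matrix n n k}
    (hA : A ∈ lieAlgebraGL T) {i j : n} (hij : i ≠ j) : A i j = 0 := by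
  have hX : (MvPolynomial.X (Sum.inl (i, j)) : MvPolynomial (GLCoord n) k) ∈ idealGL T := by
    refine mem_idealGL_iff.2 fun g hg => ?_
    obtain ⟨d, rfl⟩ := hT hg
    rw [eval_X, glCoordFun_inl, coe_diagonalGL, Matrix.diagonal_apply_ne _ hij]
  have h := (mem_lieAlgebraGL_iff.1 hA) _ hX
  rwa [tangentDeriv_X] at h

/-- Every element of `Lie(T)`, `T ≤ 𝔻ₙ`, is a diagonal matrix. [cite: SpringerLAG1998, 4.4.10 (3)] -/
theorem exists_eq_diagonal_of_mem_lieAlgebraGL (hT : T ≤ diagonalSubgroup n k) {A : Matrix n n k}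
    (hA : A ∈ lieAlgebraGL T) : ∃ v : n → k, A = Matrix.diagonal v := by
  refine ⟨fun i => A i i, Matrix.ext fun i j => ?_⟩
  by_cases hij : i = j
  · subst hij; rw [Matrix.diagonal_apply_eq]
  · rw [Matrix.diagonal_apply_ne _ hij, apply_eq_zero_of_mem_lieAlgebraGL hT hA hij]

end Diagonal

/-! ### The Euler derivations of `k[ℤⁿ]` -/

section Euler

omit [DecidableEq n] in
/-- The pairing `⟨m, v⟩ = ∑ᵢ mᵢ vᵢ` of an exponent vector `m ∈ ℤⁿ` with `v ∈ kⁿ` (the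
differential at `1` of the character `t ↦ t^m` of `𝔻ₙ` on the tangent vector `diag(v)`).
[folklore] -/
def zdot (m : n → ℤ) (v : n → k) : k := ∑ i, (m i : k) * v i

omit [DecidableEq n] in
/-- `⟨m + m', v⟩ = ⟨m, v⟩ + ⟨m', v⟩`. [folklore] -/
lemma zdot_add (m m' : n → ℤ) (v : n → k) : zdot (m + m') v = zdot m v + zdot m' v := by
  simp [zdot, add_mul, Finset.sum_add_distrib]

omit [DecidableEq n] in
/-- `⟨0, v⟩ = 0`. [folklore] -/
lemma zdot_zero (v : n → k) : zdot (0 : n → ℤ) v = 0 := by simp [zdot]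

omit [DecidableEq n] in
/-- `⟨m - m', v⟩ = ⟨m, v⟩ - ⟨m', v⟩`. [folklore] -/
lemma zdot_sub (m m' : n → ℤ) (v : n → k) : zdot (m - m') v = zdot m v - zdot m' v := by
  simp [zdot, sub_mul, Finset.sum_sub_distrib]

/-- `⟨eᵢ, v⟩ = vᵢ`. [folklore] -/
lemma zdot_single (i : n) (v : n → k) : zdot (Pi.single i 1) v = v i := by
  rw [zdot, Finset.sum_eq_single i (fun j _ hj => by simp [hj]) (by simp)]
  simp

omit [DecidableEq n] in
/-- `⟨-𝟙, v⟩ = -∑ vᵢ`. [folklore] -/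
lemma zdot_neg_one (v : n → k) : zdot (fun _ => (-1 : ℤ)) v = - ∑ i, v i := by
  simp [zdot]

omit [Fintype n] [DecidableEq n] in
/-- The coefficients of a monomial of `k[ℤⁿ]`. [folklore] -/
lemma coeff_laurentSingle (m : n → ℤ) (a : k) :
    (AddMonoidAlgebra.single m a : AddMonoidAlgebra k (n → ℤ)).coeff = Finsupp.single m a := rfl

variable (v : n → k)

omit [DecidableEq n] in
/-- The **Euler derivation** `E_v : t^m ↦ ⟨m, v⟩ t^m` of the Laurent polynomial ring `k[ℤⁿ]`
(the restriction to `𝔻ₙ` of the derivation `D_{diag(v)}`, `laurentRestrict_rDeriv_diagonal`).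
[folklore] -/
def laurentDeriv (L : AddMonoidAlgebra k (n → ℤ)) : AddMonoidAlgebra k (n → ℤ) :=
  L.coeff.sum fun m a => AddMonoidAlgebra.single m (zdot m v * a)

omit [DecidableEq n] in
/-- `E_v (a t^m) = ⟨m, v⟩ a t^m`. [folklore] -/
@[simp] lemma laurentDeriv_single (m : n → ℤ) (a : k) :
    laurentDeriv v (AddMonoidAlgebra.single m a) = AddMonoidAlgebra.single m (zdot m v * a) := by
  rw [laurentDeriv, coeff_laurentSingle, Finsupp.sum_single_index]
  simp

omit [DecidableEq n] in
/-- `E_v 0 = 0`. [folklore] -/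
@[simp] lemma laurentDeriv_zero : laurentDeriv v (0 : AddMonoidAlgebra k (n → ℤ)) = 0 := by
  simp [laurentDeriv]

omit [DecidableEq n] in
/-- `E_v` is additive. [folklore] -/
lemma laurentDeriv_add (L L' : AddMonoidAlgebra k (n → ℤ)) :
    laurentDeriv v (L + L') = laurentDeriv v L + laurentDeriv v L' := by
  simp only [laurentDeriv, AddMonoidAlgebra.coeff_add]
  rw [Finsupp.sum_add_index']
  · intro m; simp
  · intro m a b; simp [mul_add]

omit [DecidableEq n] in
/-- `E_v` is `k`-linear. [folklore] -/
lemma laurentDeriv_smul (c : k) (L : AddMonoidAlgebra k (n → ℤ)) :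
    laurentDeriv v (c • L) = c • laurentDeriv v L := by
  induction L using AddMonoidAlgebra.induction_linear with
  | zero => simp
  | add L L' hL hL' => rw [smul_add, laurentDeriv_add, laurentDeriv_add, hL, hL', smul_add]
  | single m a =>
    rw [AddMonoidAlgebra.smul_single, laurentDeriv_single, laurentDeriv_single,
      AddMonoidAlgebra.smul_single, smul_eq_mul, smul_eq_mul, mul_left_comm]

omit [DecidableEq n] in
/-- The Leibniz rule of `E_v` against a monomial: `E_v (L t^m) = E_v (L) t^m + ⟨m, v⟩ L t^m`.
[folklore] -/
lemma laurentDeriv_mul_single (L : AddMonoidAlgebra k (n → ℤ)) (m : n → ℤ) (b : k) :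
    laurentDeriv v (L * AddMonoidAlgebra.single m b) =
      laurentDeriv v L * AddMonoidAlgebra.single m b +
        zdot m v • (L * AddMonoidAlgebra.single m b) := by
  induction L using AddMonoidAlgebra.induction_linear with
  | zero => simp
  | add L L' hL hL' =>
    rw [add_mul, laurentDeriv_add, hL, hL', laurentDeriv_add, add_mul, smul_add]
    abel
  | single m' a =>
    rw [AddMonoidAlgebra.single_mul_single, laurentDeriv_single, laurentDeriv_single,
      AddMonoidAlgebra.single_mul_single, AddMonoidAlgebra.smul_single, zdot_add, smul_eq_mul,
      ← AddMonoidAlgebra.single_add]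
    congr 1
    ring

omit [DecidableEq n] in
/-- The coefficients of `E_v L`: `(E_v L)(m) = ⟨m, v⟩ L(m)`. [folklore] -/
lemma coeff_laurentDeriv (L : AddMonoidAlgebra k (n → ℤ)) (m : n → ℤ) :
    (laurentDeriv v L).coeff m = zdot m v * L.coeff m := by
  classical
  induction L using AddMonoidAlgebra.induction_linear with
  | zero => simp
  | add L L' hL hL' =>
    rw [laurentDeriv_add, AddMonoidAlgebra.coeff_add, AddMonoidAlgebra.coeff_add, Finsupp.add_apply,
      Finsupp.add_apply, hL, hL', mul_add]
  | single m' a =>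
    rw [laurentDeriv_single, coeff_laurentSingle, coeff_laurentSingle, Finsupp.single_apply,
      Finsupp.single_apply]
    split_ifs with h
    · subst h; rfl
    · rw [mul_zero]

/-- **Restriction to the diagonal intertwines `D_{diag(v)}` with the Euler derivation `E_v`**:
`(D_{diag(v)} p)|_{𝔻ₙ} = E_v (p|_{𝔻ₙ})` — on generators, `x_{ii} ↦ vᵢ tᵢ = ⟨eᵢ, v⟩ tᵢ`,
`x_{ij} ↦ 0` (`i ≠ j`), `y ↦ -(∑ vᵢ) t^{-𝟙} = ⟨-𝟙, v⟩ t^{-𝟙}`. [folklore] -/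
theorem laurentRestrict_rDeriv_diagonal (p : MvPolynomial (GLCoord n) k) :
    laurentRestrict n k (rDeriv (Matrix.diagonal v) p) = laurentDeriv v (laurentRestrict n k p) := by
  induction p using MvPolynomial.induction_on with
  | C a =>
    rw [rDeriv_C, map_zero, MvPolynomial.algHom_C]
    change 0 = laurentDeriv v (AddMonoidAlgebra.single 0 (algebraMap k k a))
    rw [laurentDeriv_single, zdot_zero, zero_mul, AddMonoidAlgebra.single_zero]
  | add p q hp hq => rw [map_add, map_add, map_add, laurentDeriv_add, hp, hq]
  | mul_X p c hp =>
    rw [Derivation.leibniz, map_add, smul_eq_mul, smul_eq_mul, map_mul, map_mul, map_mul, hp,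
      rDeriv_X, rDerivVal_diagonal, map_mul, MvPolynomial.algHom_C]
    rcases c with ⟨i, j⟩ | u
    · by_cases hij : i = j
      · subst hij
        have hX : laurentRestrict n k (MvPolynomial.X (Sum.inl (i, i))) =
            AddMonoidAlgebra.single (Pi.single i 1) 1 := by
          simp [laurentRestrict]
        rw [hX, laurentDeriv_mul_single, rDerivWeight, zdot_single, Algebra.algebraMap_eq_smul_one,
          smul_mul_assoc, one_mul, mul_smul_comm, add_comm, mul_comm (AddMonoidAlgebra.single _ _)]
      · have hX : laurentRestrict n k (MvPolynomial.X (Sum.inl (i, j))) = 0 := by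
          simp [laurentRestrict, hij]
        simp [hX]
    · have hX : laurentRestrict n k (MvPolynomial.X (Sum.inr u)) =
          AddMonoidAlgebra.single (fun _ => (-1 : ℤ)) 1 := by
        simp [laurentRestrict]
      rw [hX, laurentDeriv_mul_single, rDerivWeight, ← zdot_neg_one, Algebra.algebraMap_eq_smul_one,
        smul_mul_assoc, one_mul, mul_smul_comm, add_comm, mul_comm (AddMonoidAlgebra.single _ _)]

end Euler

/-! ### Tangent vectors from the character relations: `diag(v) ∈ Lie(T)` -/

section Membership

variable {T : Subgroup (GL n k)}

/-- **Characters trivial on `T` cut out `Lie(T)` (inclusion `⊇`)**: let `T ≤ 𝔻ₙ` be a subgroup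
(no closedness needed: `Lie(T)` only depends on the closure of `T`) and `v ∈ kⁿ` with `⟨m, v⟩ = 0` for every `m ∈ ℤⁿ` whose monomial character `t ↦ t^m`
is trivial on `T`. Then `diag(v) ∈ Lie(T)`. Proof: by `mem_lieAlgebraGL_iff_forall_rDeriv_mem`
it suffices that `D_{diag(v)}` preserves `𝓘(T)`; for `p ∈ 𝓘(T)` restrict to the diagonal
(`laurentRestrict_rDeriv_diagonal`): by Dedekind's theorem the coefficients of `p|_{𝔻ₙ}` sum to
zero over each class of exponents with the same character on `T`
(`sum_filter_eq_zero_of_sum_smul_monoidHom_eq_zero`), and `E_v` multiplies such a class by the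
constant `⟨m, v⟩` (two exponents of one class differ by an `m` with `t^m|_T = 1`), so
`(D_{diag(v)} p)(t) = 0` for `t ∈ T` (Springer 3.2.10 (4) with 4.4.10 (3): the Lie algebra of
`⋂ Ker χ` inside `Lie(𝔻ₙ) = 𝔡ₙ`). [cite: SpringerLAG1998, 3.2.10 (4) and 4.4.10 (3)] -/
theorem diagonal_mem_lieAlgebraGL_of_forall_diagChar (hT : T ≤ diagonalSubgroup n k) {v : n → k}
    (hv : ∀ m : n → ℤ, diagChar hT m = 1 → zdot m v = 0) :
    Matrix.diagonal v ∈ lieAlgebraGL T := by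
  classical
  rw [mem_lieAlgebraGL_iff_forall_rDeriv_mem]
  intro p hp
  refine mem_idealGL_iff.2 fun t ht => ?_
  set L := laurentRestrict n k p with hL
  -- `p` vanishes on `T`
  have hvan : ∀ t : ↥T, MvPolynomial.eval (glCoordFun (t : GL n k)) p = 0 := fun t =>
    mem_idealGL_iff.1 hp _ t.2
  let ψ : (n → ℤ) → ↥T →* k := fun m => (Units.coeHom k).comp (diagChar hT m)
  have hfun : ∑ m ∈ L.coeff.support, L.coeff m • (⇑(ψ m) : ↥T → k) = 0 := by
    funext t
    rw [Finset.sum_apply, Pi.zero_apply]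
    simp only [ψ, Pi.smul_apply, MonoidHom.coe_comp, Function.comp_apply, Units.coeHom_apply,
      smul_eq_mul]
    have := hvan t
    rw [← diagonalGL_diagCoord hT t, eval_glCoordFun_diagonalGL, laurentEval_apply,
      Finsupp.sum] at this
    simpa only [diagChar_apply] using this
  have hfiber := sum_filter_eq_zero_of_sum_smul_monoidHom_eq_zero _ _ _ hfun
  -- `⟨m, v⟩` is constant on the classes of `ψ`
  have hclass : ∀ m m' : n → ℤ, ψ m = ψ m' → zdot m v = zdot m' v := by
    intro m m' hmm'
    have h1 : diagChar hT (m - m') = 1 := by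
      refine MonoidHom.ext fun t => ?_
      have ht : diagChar hT m t = diagChar hT m' t := Units.ext (DFunLike.congr_fun hmm' t)
      rw [MonoidHom.one_apply, diagChar_apply]
      simp only [Pi.sub_apply, zpow_sub, Finset.prod_mul_distrib, Finset.prod_inv_distrib]
      rw [← diagChar_apply, ← diagChar_apply, ht, mul_inv_cancel]
    have h2 := hv _ h1
    rwa [zdot_sub, sub_eq_zero] at h2
  -- evaluate `D_{diag v} p` at `t = diag (diagCoord t)`
  let t' : ↥T := ⟨t, ht⟩
  set d := diagCoord hT t' with hd
  have htd : t = diagonalGL n k d := (diagonalGL_diagCoord hT t').symm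
  rw [htd, eval_glCoordFun_diagonalGL, laurentRestrict_rDeriv_diagonal, laurentEval_apply,
    Finsupp.sum_of_support_subset _ (s := L.coeff.support) ?_ _ (fun m _ => by rw [zero_mul])]
  swap
  · intro m hm
    rw [Finsupp.mem_support_iff] at hm ⊢
    rw [coeff_laurentDeriv] at hm
    exact right_ne_zero_of_mul hm
  simp only [coeff_laurentDeriv]
  rw [← Finset.sum_fiberwise_of_maps_to (t := L.coeff.support.image ψ) (g := ψ)
      fun j hj => Finset.mem_image_of_mem ψ hj]
  refine Finset.sum_eq_zero fun f hf => ?_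
  obtain ⟨m₀, hm₀, rfl⟩ := Finset.mem_image.mp hf
  have hψt : ∀ j : n → ℤ, ψ j = ψ m₀ →
      ((∏ i, d i ^ j i : kˣ) : k) = ((∏ i, d i ^ m₀ i : kˣ) : k) := by
    intro j hj
    have h := DFunLike.congr_fun hj t'
    simp only [ψ, MonoidHom.coe_comp, Function.comp_apply, Units.coeHom_apply, diagChar_apply] at h
    exact h
  have : ∀ j ∈ L.coeff.support.filter (fun j => ψ j = ψ m₀),
      zdot j v * L.coeff j * ((∏ i, d i ^ j i : kˣ) : k) =
        zdot m₀ v * ((∏ i, d i ^ m₀ i : kˣ) : k) * L.coeff j := by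
    intro j hj
    rw [hclass j m₀ (Finset.mem_filter.mp hj).2, hψt j (Finset.mem_filter.mp hj).2]
    ring
  rw [Finset.sum_congr rfl this, ← Finset.mul_sum, hfiber (ψ m₀), mul_zero]

end Membership

end Literature.NumberTheory.Automorphic
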